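import Mathlib.LinearAlgebra.Dimension.Finrank
import Mathlib.LinearAlgebra.FiniteDimensional.Defs
import Mathlib.LinearAlgebra.FiniteDimensional.Lemmas
import Mathlib.LinearAlgebra.Dimension.Constructions
import Mathlib.Algebra.BigOperators.Fin
import HarnessLib

/-!
# Route `AdditiveKolyvaginRoad`, crux `LevelKolyvaginSystemsAdditive` (item stmt-BirchSwinnertonDyer-21396, KS′):
# the THREE-LAGRANGIAN SWITCH — two distinct isotropic lines at ONE place move a Selmer rank by EXACTLY one
# (pure linear algebra; cell `pub/bsd-wall`, width seat `bsd-wall-akr-p2x-w3` g0 on line `birth`;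
# `--supports stmt-BirchSwinnertonDyer-21396`, helper — the kernel identity engine named by the round-1 crux ideas
# `epsilon-matched-retyping` («3-Lagrangian lemma: dim Sel_{L_f} − dim Sel_{L_g} ≡ [L_f ≠ L_g] (mod 2)») and
# `depleted-shadow-transfer` (A1) («a swap at the single place p flips dim Sel_p (mod 2)»), scoped by width seat w2)

WHAT. Coefficient field `F` with `2 ≠ 0`. A «local» plane `H` (`dim H = 2`; meant: `H¹(ℚ_p, E[p])` at a place where
`E[p]` has no local invariants, Poonen–Rains) with a SYMMETRIC NON-DEGENERATE bilinear form `b` (the local Tate pairing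
of the Weil pairing; symmetric by the (1,1) sign and skewness, lead akr-p2x `invWeilPairing_comm`); a «global relaxed»
space `T ≤ V` with a «localisation» `loc : V → H` whose image is TOTALLY ISOTROPIC (Poitou–Tate reciprocity: two
classes unramified ∕ self-orthogonal at every other place pair to zero at the last one) and NON-ZERO (the Poitou–Tate
JUMP `[relaxed : strict] = p`); two ISOTROPIC vectors `l, l'` spanning DISTINCT lines (two Lagrangian local conditions
at the place: E's Kummer line and a congruent form's Kummer line transported along `ρ̄_E ≅ ρ̄_g`). THEN:

* `mem_span_or_mem_span_of_isotropic` — every isotropic vector of the plane lies on one of the two lines (in the basis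
  `l, l'`: `b(αl + α'l', αl + α'l') = 2αα'·b(l,l')` with `b(l,l') ≠ 0` by non-degeneracy);
* `map_le_span_or_map_le_span` — the image `loc(T)` lies INSIDE one of the two lines;
* `finrank_inf_comap_switch` — the two Selmer groups `Sel_l = T ∩ loc⁻¹(F·l)` and `Sel_{l'} = T ∩ loc⁻¹(F·l')` have
  dimensions differing by EXACTLY ONE (one of them is all of `T`, the other the strict group `T ∩ ker loc`, and
  `dim T = dim (T ∩ ker loc) + 1`);
* `odd_finrank_add_of_switch` — hence `dim Sel_l + dim Sel_{l'}` is ODD: the parity form the ideas use (with p-parity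
  for both forms and equal global root numbers it FORBIDS `L_E ≠ L_g`, i.e. forces the Kummer lines at `p` to coincide).

HONEST FRAMING: pure linear algebra over an arbitrary field of characteristic `≠ 2`; 0 definitions, 0 named facts,
0 `sorry`; no number theory is asserted — the reciprocity (isotropy), the jump, the plane count and the Lagrangian
property of the Kummer lines are HYPOTHESES here, to be discharged at the place `p` by the Poitou–Tate inputs of the
route (DUAL.2) exactly as akr-p1 ∕ akr-p2x did at admissible places. Closes nothing. BSD is not proved by any of this.

References: [cite: PoonenRains2012, Prop. 4.11 (H¹(ℚ_v, E[p]) quadratic space, Kummer image maximal isotropic)]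
[cite: MilneADT2006, Ch. I, Thm. 4.10] [cite: WZhang2014, Lemma 5.3] [cite: BertoliniDarmon2005, Lemma 2.6].
-/

-- single-conjunct summit: `Summit.BirchSwinnertonDyer.BirchSwinnertonDyer.…` repeats the name by design
set_option linter.dupNamespace false

namespace Summit.BirchSwinnertonDyer.BirchSwinnertonDyer.Theorems.AdditiveKoly.LagrangianSwitch

open Module

variable {F : Type*} [Field F] {V H : Type*} [AddCommGroup V] [Module F V] [AddCommGroup H] [Module F H]

/-! ## §1 The hyperbolic plane: isotropic vectors lie on the two isotropic lines -/

/-- **Isotropic vectors of a plane with two distinct isotropic lines.** `F` a field with `2 ≠ 0`, `H` of dimension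
`2` with a symmetric non-degenerate bilinear form `b`; `l, l'` isotropic, `l ≠ 0`, `l' ∉ F·l`. Then every isotropic
`x ∈ H` lies in `F·l` or in `F·l'`. Proof: `l, l'` is a basis; `b(l, l') ≠ 0` by non-degeneracy; for `x = αl + α'l'`,
`b(x, x) = 2αα'·b(l, l')`, so `αα' = 0`. [cite: PoonenRains2012, Prop. 4.11] [cite: MilneADT2006, Ch. I, Cor. 2.3] -/
theorem mem_span_or_mem_span_of_isotropic [FiniteDimensional F H] (h2 : (2 : F) ≠ 0) (hH : finrank F H = 2)
    (b : H →ₗ[F] H →ₗ[F] F) (hsymm : ∀ x y, b x y = b y x) (hnondeg : ∀ x, (∀ y, b x y = 0) → x = 0)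
    {l l' : H} (hl : l ≠ 0) (hl' : l' ∉ F ∙ l) (hliso : b l l = 0) (hl'iso : b l' l' = 0)
    {x : H} (hx : b x x = 0) : x ∈ F ∙ l ∨ x ∈ F ∙ l' := by
  -- `l, l'` are linearly independent, hence span the plane
  have hli : LinearIndependent F ![l, l'] := by
    refine LinearIndependent.pair_iff.mpr fun s t hst ↦ ?_
    by_cases ht : t = 0
    · subst ht
      rw [zero_smul, add_zero] at hst
      exact ⟨(smul_eq_zero.mp hst).resolve_right hl, rfl⟩
    · exfalso
      apply hl'
      rw [Submodule.mem_span_singleton]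
      refine ⟨-(t⁻¹ * s), ?_⟩
      have h : t • l' = -(s • l) := eq_neg_of_add_eq_zero_right hst
      calc -(t⁻¹ * s) • l = t⁻¹ • (-(s • l)) := by rw [neg_smul, mul_smul, smul_neg]
        _ = t⁻¹ • (t • l') := by rw [h]
        _ = l' := by rw [smul_smul, inv_mul_cancel₀ ht, one_smul]
  have hspan : Submodule.span F (Set.range ![l, l']) = ⊤ :=
    hli.span_eq_top_of_card_eq_finrank (by rw [hH]; simp)
  -- coordinates of `x`
  obtain ⟨c, hc⟩ := (Submodule.mem_span_range_iff_exists_fun F).mp (show x ∈ Submodule.span F (Set.range ![l, l'])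
    by rw [hspan]; exact Submodule.mem_top)
  rw [Fin.sum_univ_two] at hc
  simp only [Matrix.cons_val_zero, Matrix.cons_val_one] at hc
  -- `b(l, l') ≠ 0`
  have hβ : b l l' ≠ 0 := by
    intro hβ
    apply hl
    refine hnondeg l fun y ↦ ?_
    obtain ⟨d, hd⟩ := (Submodule.mem_span_range_iff_exists_fun F).mp (show y ∈ Submodule.span F (Set.range ![l, l'])
      by rw [hspan]; exact Submodule.mem_top)
    rw [Fin.sum_univ_two] at hd
    simp only [Matrix.cons_val_zero, Matrix.cons_val_one] at hd
    rw [← hd, map_add, map_smul, map_smul, smul_eq_mul, smul_eq_mul, hliso, hβ, mul_zero, mul_zero, add_zero]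
  -- `b(x, x) = 2 c₀ c₁ b(l, l')`
  have hxx : b x x = 2 * (c 0 * c 1) * b l l' := by
    rw [← hc]
    simp only [map_add, map_smul, LinearMap.add_apply, LinearMap.smul_apply, smul_eq_mul, hliso, hl'iso,
      hsymm l' l]
    ring
  rw [hx] at hxx
  have hprod : c 0 * c 1 = 0 := by
    rcases mul_eq_zero.mp hxx.symm with h | h
    · exact (mul_eq_zero.mp h).resolve_left h2
    · exact absurd h hβ
  rcases mul_eq_zero.mp hprod with h0 | h1
  · right
    rw [Submodule.mem_span_singleton]
    exact ⟨c 1, by rw [← hc, h0, zero_smul, zero_add]⟩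
  · left
    rw [Submodule.mem_span_singleton]
    exact ⟨c 0, by rw [← hc, h1, zero_smul, add_zero]⟩

/-! ## §2 The image of a totally isotropic «relaxed» space lies on ONE of the two lines -/

/-- In the situation of `mem_span_or_mem_span_of_isotropic`, a line `F·l` and its partner `F·l'` meet trivially.
[folklore] -/
theorem mem_span_inf_span_eq_zero {l l' : H} (hl' : l' ∉ F ∙ l) {x : H} (hx : x ∈ F ∙ l) (hx' : x ∈ F ∙ l') :
    x = 0 := by
  rw [Submodule.mem_span_singleton] at hx hx'
  obtain ⟨a, rfl⟩ := hx
  obtain ⟨a', ha'⟩ := hx'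
  by_cases ha : a' = 0
  · rw [← ha', ha, zero_smul]
  · exfalso
    apply hl'
    rw [Submodule.mem_span_singleton]
    refine ⟨a'⁻¹ * a, ?_⟩
    rw [mul_smul, ← ha', smul_smul, inv_mul_cancel₀ ha, one_smul]

/-- **The image of a totally isotropic space containing a vector on `F·l ∖ 0` lies in `F·l`.** With `b`, `l`, `l'` as
in `mem_span_or_mem_span_of_isotropic`: if `loc(T)` is totally isotropic and some `t₀ ∈ T` has `0 ≠ loc t₀ ∈ F·l`,
then `loc t ∈ F·l` for every `t ∈ T` (were `loc t ∈ F·l'`, the isotropic `loc(t₀ + t)` would lie on neither line).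
[cite: MilneADT2006, Ch. I, Thm. 4.10] -/
theorem map_le_span_of_mem [FiniteDimensional F H] (h2 : (2 : F) ≠ 0) (hH : finrank F H = 2)
    (b : H →ₗ[F] H →ₗ[F] F) (hsymm : ∀ x y, b x y = b y x) (hnondeg : ∀ x, (∀ y, b x y = 0) → x = 0)
    {l l' : H} (hl : l ≠ 0) (hl' : l' ∉ F ∙ l) (hliso : b l l = 0) (hl'iso : b l' l' = 0)
    (T : Submodule F V) (loc : V →ₗ[F] H) (hTiso : ∀ t ∈ T, ∀ t' ∈ T, b (loc t) (loc t') = 0)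
    {t₀ : V} (ht₀ : t₀ ∈ T) (ht₀l : loc t₀ ∈ F ∙ l) (ht₀0 : loc t₀ ≠ 0) :
    ∀ t ∈ T, loc t ∈ F ∙ l := by
  intro t ht
  rcases mem_span_or_mem_span_of_isotropic h2 hH b hsymm hnondeg hl hl' hliso hl'iso (hTiso t ht t ht) with h | h
  · exact h
  · -- `loc t ∈ F·l'`: look at `t₀ + t`
    rcases mem_span_or_mem_span_of_isotropic h2 hH b hsymm hnondeg hl hl' hliso hl'iso
      (hTiso _ (T.add_mem ht₀ ht) _ (T.add_mem ht₀ ht)) with h' | h'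
    · -- `loc t₀ + loc t ∈ F·l` ⟹ `loc t ∈ F·l ∩ F·l' = 0`
      rw [map_add] at h'
      have hmem : loc t ∈ F ∙ l := by
        have := (F ∙ l).sub_mem h' ht₀l
        rwa [add_sub_cancel_left] at this
      exact hmem
    · -- `loc t₀ + loc t ∈ F·l'` ⟹ `loc t₀ ∈ F·l ∩ F·l' = 0`, contradiction
      rw [map_add] at h'
      have hmem : loc t₀ ∈ F ∙ l' := by
        have := (F ∙ l').sub_mem h' h
        rwa [add_sub_cancel_right] at this
      exact absurd (mem_span_inf_span_eq_zero hl' ht₀l hmem) ht₀0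

/-! ## §3 The switch: the two Selmer groups differ in dimension by exactly one -/

/-- Rank–nullity in the shape used: if `loc` maps `T` into the line `F·l` and does not kill `T`, then
`dim (T ∩ ker loc) + 1 = dim T`. [folklore] -/
theorem finrank_inf_ker_add_one (T : Submodule F V) [FiniteDimensional F T] (loc : V →ₗ[F] H) {l : H}
    (hmem : ∀ t ∈ T, loc t ∈ F ∙ l) {t₀ : V} (ht₀ : t₀ ∈ T) (ht₀0 : loc t₀ ≠ 0) :
    finrank F ↥(T ⊓ LinearMap.ker loc) + 1 = finrank F T := by
  set g : T →ₗ[F] H := loc.comp T.subtype with hg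
  have hrange : LinearMap.range g ≤ F ∙ l := by
    rintro y ⟨x, rfl⟩
    exact hmem x x.2
  haveI : FiniteDimensional F (F ∙ l) := FiniteDimensional.span_singleton F l
  haveI : FiniteDimensional F (LinearMap.range g) := Submodule.finiteDimensional_of_le hrange
  have hle : finrank F (LinearMap.range g) ≤ 1 :=
    (Submodule.finrank_mono hrange).trans ((finrank_span_le_card ({l} : Set H)).trans (by simp))
  have hpos : finrank F (LinearMap.range g) ≠ 0 := by
    intro h0
    have hbot : LinearMap.range g = ⊥ := Submodule.finrank_eq_zero.mp h0
    have : g ⟨t₀, ht₀⟩ ∈ LinearMap.range g := LinearMap.mem_range_self g _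
    rw [hbot, Submodule.mem_bot] at this
    exact ht₀0 this
  have hone : finrank F (LinearMap.range g) = 1 := by omega
  -- `ker g ≅ T ∩ ker loc`
  have hker : finrank F (LinearMap.ker g) = finrank F ↥(T ⊓ LinearMap.ker loc) := by
    have hmapeq : (LinearMap.ker g).map T.subtype = T ⊓ LinearMap.ker loc := by
      ext x
      simp only [Submodule.mem_map, LinearMap.mem_ker, Submodule.mem_inf, hg, LinearMap.coe_comp,
        Function.comp_apply, Submodule.coe_subtype]
      constructor
      · rintro ⟨y, hy, rfl⟩
        exact ⟨y.2, hy⟩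
      · rintro ⟨hxT, hx⟩
        exact ⟨⟨x, hxT⟩, hx, rfl⟩
    rw [← hmapeq]
    exact (Submodule.finrank_map_subtype_eq T (LinearMap.ker g)).symm
  have hrn := LinearMap.finrank_range_add_finrank_ker g
  rw [hone, hker] at hrn
  omega

/-- **THE THREE-LAGRANGIAN SWITCH.** `F` a field with `2 ≠ 0`; `H` a plane with a symmetric non-degenerate form `b`;
`l ≠ 0`, `l' ∉ F·l` isotropic (two distinct Lagrangian lines); `T ≤ V` finite-dimensional with `loc : V → H` such that
`loc(T)` is TOTALLY ISOTROPIC (reciprocity) and NON-ZERO (jump). Then the Selmer groups `Sel_l := T ∩ loc⁻¹(F·l)` and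
`Sel_{l'} := T ∩ loc⁻¹(F·l')` satisfy `dim Sel_{l'} + 1 = dim Sel_l` or `dim Sel_l + 1 = dim Sel_{l'}`: `loc(T)` lies in
exactly one of the two lines (§1–§2); for that line the Selmer group is all of `T`, for the other it is `T ∩ ker loc`,
of codimension one (rank–nullity). The case `L = L'` being trivial (equal groups), this is «dim Sel_L − dim Sel_{L'} ≡
[L ≠ L'] (mod 2)» for two Lagrangian conditions at ONE place of a self-dual Selmer structure — the engine of the
parity-forced identity of Kummer lines in the crux ideas `depleted-shadow-transfer` (A1) ∕ `epsilon-matched-retyping`.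
[cite: MilneADT2006, Ch. I, Thm. 4.10] [cite: PoonenRains2012, Prop. 4.11] [cite: WZhang2014, Lemma 5.3] -/
theorem finrank_inf_comap_switch [FiniteDimensional F H] (h2 : (2 : F) ≠ 0) (hH : finrank F H = 2)
    (b : H →ₗ[F] H →ₗ[F] F) (hsymm : ∀ x y, b x y = b y x) (hnondeg : ∀ x, (∀ y, b x y = 0) → x = 0)
    {l l' : H} (hl : l ≠ 0) (hl' : l' ∉ F ∙ l) (hliso : b l l = 0) (hl'iso : b l' l' = 0)
    (T : Submodule F V) [FiniteDimensional F T] (loc : V →ₗ[F] H)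
    (hTiso : ∀ t ∈ T, ∀ t' ∈ T, b (loc t) (loc t') = 0) (hjump : ∃ t ∈ T, loc t ≠ 0) :
    finrank F ↥(T ⊓ (F ∙ l').comap loc) + 1 = finrank F ↥(T ⊓ (F ∙ l).comap loc) ∨
      finrank F ↥(T ⊓ (F ∙ l).comap loc) + 1 = finrank F ↥(T ⊓ (F ∙ l').comap loc) := by
  obtain ⟨t₀, ht₀, ht₀0⟩ := hjump
  -- the symmetric hypotheses for the pair `(l', l)`
  have hl'0 : l' ≠ 0 := fun h ↦ hl' (h ▸ Submodule.zero_mem _)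
  have hll' : l ∉ F ∙ l' := by
    intro h
    rw [Submodule.mem_span_singleton] at h
    obtain ⟨a, ha⟩ := h
    have ha0 : a ≠ 0 := by rintro rfl; exact hl (by rw [← ha, zero_smul])
    exact hl' (Submodule.mem_span_singleton.mpr ⟨a⁻¹, by rw [← ha, smul_smul, inv_mul_cancel₀ ha0, one_smul]⟩)
  -- generic step: if `loc t₀` lies on the line `F·m` (partner `m'`), then `Sel_{m'} + 1 = Sel_m`
  have step : ∀ {m m' : H}, m ≠ 0 → m' ∉ F ∙ m → b m m = 0 → b m' m' = 0 → loc t₀ ∈ F ∙ m →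
      finrank F ↥(T ⊓ (F ∙ m').comap loc) + 1 = finrank F ↥(T ⊓ (F ∙ m).comap loc) := by
    intro m m' hm hm' hmiso hm'iso ht₀m
    have hall : ∀ t ∈ T, loc t ∈ F ∙ m :=
      map_le_span_of_mem h2 hH b hsymm hnondeg hm hm' hmiso hm'iso T loc hTiso ht₀ ht₀m ht₀0
    -- `Sel_m = T`
    have hSelm : T ⊓ (F ∙ m).comap loc = T :=
      le_antisymm inf_le_left fun t ht ↦ ⟨ht, Submodule.mem_comap.mpr (hall t ht)⟩
    -- `Sel_{m'} = T ∩ ker loc`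
    have hSelm' : T ⊓ (F ∙ m').comap loc = T ⊓ LinearMap.ker loc := by
      ext t
      simp only [Submodule.mem_inf, Submodule.mem_comap, LinearMap.mem_ker]
      constructor
      · rintro ⟨ht, htm'⟩
        exact ⟨ht, mem_span_inf_span_eq_zero hm' (hall t ht) htm'⟩
      · rintro ⟨ht, h0⟩
        exact ⟨ht, by rw [h0]; exact Submodule.zero_mem _⟩
    rw [hSelm, hSelm']
    exact finrank_inf_ker_add_one T loc hall ht₀ ht₀0
  rcases mem_span_or_mem_span_of_isotropic h2 hH b hsymm hnondeg hl hl' hliso hl'iso (hTiso t₀ ht₀ t₀ ht₀) with h | h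
  · exact Or.inl (step hl hl' hliso hl'iso h)
  · exact Or.inr (step hl'0 hll' hl'iso hliso h)

/-! ## §4 The parity form -/

/-- **Parity form of the switch**: under the hypotheses of `finrank_inf_comap_switch`, `dim Sel_l + dim Sel_{l'}` is
ODD. With the p-parity theorem for the two self-dual families and EQUAL global root numbers, two distinct Lagrangian
Kummer lines at the one place would give Selmer ranks of different parity — contradiction; so the lines coincide
(the ideas' «Kummer line at `p` read off the local root number»). [cite: PoonenRains2012, Prop. 4.11]
[cite: WZhang2014, Lemma 5.3] -/
theorem odd_finrank_add_of_switch [FiniteDimensional F H] (h2 : (2 : F) ≠ 0) (hH : finrank F H = 2)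
    (b : H →ₗ[F] H →ₗ[F] F) (hsymm : ∀ x y, b x y = b y x) (hnondeg : ∀ x, (∀ y, b x y = 0) → x = 0)
    {l l' : H} (hl : l ≠ 0) (hl' : l' ∉ F ∙ l) (hliso : b l l = 0) (hl'iso : b l' l' = 0)
    (T : Submodule F V) [FiniteDimensional F T] (loc : V →ₗ[F] H)
    (hTiso : ∀ t ∈ T, ∀ t' ∈ T, b (loc t) (loc t') = 0) (hjump : ∃ t ∈ T, loc t ≠ 0) :
    Odd (finrank F ↥(T ⊓ (F ∙ l).comap loc) + finrank F ↥(T ⊓ (F ∙ l').comap loc)) := by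
  rcases finrank_inf_comap_switch h2 hH b hsymm hnondeg hl hl' hliso hl'iso T loc hTiso hjump with h | h
  · exact ⟨finrank F ↥(T ⊓ (F ∙ l').comap loc), by omega⟩
  · exact ⟨finrank F ↥(T ⊓ (F ∙ l).comap loc), by omega⟩

end Summit.BirchSwinnertonDyer.BirchSwinnertonDyer.Theorems.AdditiveKoly.LagrangianSwitch
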